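import Summits.RiemannHypothesis.RiemannHypothesis.Theorems.JensenLogBandShellFarPieces
import HarnessLib

/-!
# Numerical bookkeeping for the near zone of the top shell (BAND line, `stub_shellNear`)

RH ladder column JENSEN, rung J-P(P3) «log band», BAND crux `XiDerivBandRealAllRates`
(stmt-RiemannHypothesis-19913) of route «JensenLogBand», line «band-one-window» (u-arc, top-shell
reshape), lead rh-jensen-prover g8. RH-FREE real arithmetic. WHAT THIS IS NOT: nothing here bears on
zeros of `ζ` or the truth of RH.

At every point of a transfer disc the window lemma (`LogBandArc.norm_xiSqArcU_sub_arcMainTerm_le'`)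
must be TWO-SIDED with relative error `≤ 1/3` (not merely «competitor < own»), so the window bracket
is pushed to `≤ (1/10)/√k` and the flank/bridge junk to `≤ τ/√k` for an arbitrary target `τ`:

* `eta_le_hundredth`: `η = (r/160)e^{r/160} ≤ 1/100` for `0 ≤ r ≤ 1`;
* `window_bracket_le_tenth`: `W ≤ (1/10)/√k` when `Re w ≥ 11k/40`, `η ≤ 1/100`, `13000√k ≤ k`,
  `(4800/(11ψ₁))·k²·e^{−(11ψ₁²/40)k} ≤ 1`;
* `log_height_le'`: `log(T + y) ≤ 4 + 4k` from `ℓ_T ≤ ck/2 + 1`, `c < 8`;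
* `gain_exp_le'`: `e^{−(σ−1−δ')(ℓ/2−1)} ≤ 2e^{−(7a₀/4)k}` from `7k/4 − 5 ≤ ℓ/2 − 1`;
* `near_junk_le`: `π·F + d·V ≤ τ/√k` given the two exponential-decay hypotheses;
* `disc_bound_core`: the abstract combination `‖U − M̃‖ ≤ ‖M̃‖/3` from the window lemma, the main-term
  size, `W ≤ (1/10)/q`, junk `≤ (z₀/100)/q` and the model comparison `≤ 1/100`.
-/

noncomputable section

-- single-problem summit: `Summit.RiemannHypothesis.RiemannHypothesis.…` is the tree convention
set_option linter.dupNamespace false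

open Real

namespace Summit.RiemannHypothesis.RiemannHypothesis.Theorems.JensenPolynomials.LogBandArc

/-- `η = (r/160)·e^{r/160} ≤ 1/100` (and `≥ 0`) for `0 ≤ r ≤ 1`. [folklore] -/
theorem eta_le_hundredth {r a₀ : ℝ} (hr0 : 0 ≤ r) (hr1 : r ≤ 1) (ha₀ : 0 < a₀) :
    0 ≤ r * (a₀ / 160) / a₀ * Real.exp (r * (a₀ / 160) / a₀) ∧
      r * (a₀ / 160) / a₀ * Real.exp (r * (a₀ / 160) / a₀) ≤ 1 / 100 := by
  refine ⟨by positivity, ?_⟩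
  have hη : r * (a₀ / 160) / a₀ = r / 160 := by field_simp
  rw [hη]
  have hx1 : |r / 160| ≤ 1 := by rw [abs_le]; constructor <;> linarith
  have he := (abs_le.1 (Real.abs_exp_sub_one_le hx1)).2
  have hr160 : |r / 160| ≤ 1 / 160 := by rw [abs_le]; constructor <;> linarith
  have hexp : Real.exp (r / 160) ≤ 3 / 2 := by linarith
  have : r / 160 * Real.exp (r / 160) ≤ 1 / 160 * (3 / 2) :=
    mul_le_mul (by linarith) hexp (Real.exp_pos _).le (by norm_num)
  linarith

/-- **The window bracket is `≤ (1/10)/√k`.** [folklore] -/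
theorem window_bracket_le_tenth {k : ℕ} {Rw η ψ₁ : ℝ} (hk : 1 ≤ (k : ℝ))
    (hRw : 11 * (k : ℝ) / 40 ≤ Rw) (hη0 : 0 ≤ η) (hη : η ≤ 1 / 100) (hψ₁ : 0 < ψ₁)
    (hE1 : 13000 * Real.sqrt k ≤ k)
    (hE2 : 4800 / (11 * ψ₁) * (k : ℝ) ^ 2 * Real.exp (-(11 * ψ₁ ^ 2 / 40 * k)) ≤ 1) :
    4 * (1 + η) * (4 * k) / Rw ^ 2 + η * Real.sqrt (π / Rw) + 2 / (Rw * ψ₁) * Real.exp (-Rw * ψ₁ ^ 2) ≤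
      1 / 10 / Real.sqrt k := by
  have hk0 : (0 : ℝ) < k := by linarith
  have hRw0 : 0 < Rw := by linarith
  have hsk : 0 < Real.sqrt k := Real.sqrt_pos.2 hk0
  have hsk1 : 1 ≤ Real.sqrt k := by
    rw [show (1 : ℝ) = Real.sqrt 1 by simp]; exact Real.sqrt_le_sqrt hk
  have hsq : Real.sqrt k * Real.sqrt k = k := Real.mul_self_sqrt hk0.le
  -- term 1: `16(1+η)k/Rw² ≤ 216/k ≤ 1/(60√k)`
  have h1 : 4 * (1 + η) * (4 * k) / Rw ^ 2 ≤ 1 / (60 * Real.sqrt k) := by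
    have hA : 4 * (1 + η) * (4 * (k : ℝ)) / Rw ^ 2 ≤ 4 * (1 + η) * (4 * k) / (11 * k / 40) ^ 2 := by
      apply div_le_div_of_nonneg_left (by positivity) (by positivity)
      exact pow_le_pow_left₀ (by positivity) hRw 2
    refine hA.trans ?_
    rw [div_le_div_iff₀ (by positivity) (by positivity)]
    have hks : 0 ≤ (k : ℝ) * Real.sqrt k := by positivity
    have hA1 : 4 * (1 + η) * (4 * (k : ℝ)) * (60 * Real.sqrt k) = (960 * (1 + η)) * (k * Real.sqrt k) := by
      ring
    have hA2 : (960 * (1 + η)) * ((k : ℝ) * Real.sqrt k) ≤ 970 * (k * Real.sqrt k) :=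
      mul_le_mul_of_nonneg_right (by linarith) hks
    have hA3 : 13000 * ((k : ℝ) * Real.sqrt k) ≤ k * k := by
      have := mul_le_mul_of_nonneg_left hE1 hk0.le
      linarith [this]
    rw [hA1]
    nlinarith
  -- term 2: `η √(π/Rw) ≤ (1/100)·(3.5/√k)`
  have h2 : η * Real.sqrt (π / Rw) ≤ 7 / 200 / Real.sqrt k := by
    have hpi : π < 3.1416 := Real.pi_lt_d4
    have hB : π / Rw ≤ (49 / 4) / k := by
      rw [div_le_div_iff₀ hRw0 hk0]; nlinarith
    have hC : Real.sqrt (π / Rw) ≤ (7 / 2) / Real.sqrt k := by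
      have : Real.sqrt ((49 / 4) / k) = (7 / 2) / Real.sqrt k := by
        rw [Real.sqrt_div (by norm_num), show (49 / 4 : ℝ) = (7 / 2) ^ 2 by norm_num,
          Real.sqrt_sq (by norm_num)]
      rw [← this]; exact Real.sqrt_le_sqrt hB
    calc η * Real.sqrt (π / Rw) ≤ (1 / 100) * ((7 / 2) / Real.sqrt k) :=
          mul_le_mul hη hC (Real.sqrt_nonneg _) (by norm_num)
      _ = 7 / 200 / Real.sqrt k := by ring
  -- term 3
  have h3 : 2 / (Rw * ψ₁) * Real.exp (-Rw * ψ₁ ^ 2) ≤ 1 / (60 * Real.sqrt k) := by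
    have hmono := tail_term_antitone (by positivity : (0 : ℝ) < 11 * k / 40) hRw hψ₁
    refine hmono.trans ?_
    have hexp_eq : Real.exp (-(11 * (k : ℝ) / 40) * ψ₁ ^ 2) = Real.exp (-(11 * ψ₁ ^ 2 / 40 * k)) := by
      congr 1; ring
    rw [hexp_eq]
    have hE : Real.exp (-(11 * ψ₁ ^ 2 / 40 * k)) ≤ 1 / (4800 / (11 * ψ₁) * (k : ℝ) ^ 2) := by
      rw [le_div_iff₀ (by positivity)]
      nlinarith [Real.exp_pos (-(11 * ψ₁ ^ 2 / 40 * k))]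
    calc 2 / (11 * (k : ℝ) / 40 * ψ₁) * Real.exp (-(11 * ψ₁ ^ 2 / 40 * k))
        ≤ 2 / (11 * (k : ℝ) / 40 * ψ₁) * (1 / (4800 / (11 * ψ₁) * (k : ℝ) ^ 2)) :=
          mul_le_mul_of_nonneg_left hE (by positivity)
      _ = 1 / (60 * (k : ℝ) ^ 3) := by field_simp; ring
      _ ≤ 1 / (60 * Real.sqrt k) := by
          apply div_le_div_of_nonneg_left (by norm_num) (by positivity)
          have hs_le : Real.sqrt k ≤ k := by nlinarith
          nlinarith
  have hsum : 1 / (60 * Real.sqrt k) + 7 / 200 / Real.sqrt k + 1 / (60 * Real.sqrt k) ≤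
      1 / 10 / Real.sqrt k := by
    have : 1 / (60 * Real.sqrt k) + 7 / 200 / Real.sqrt k + 1 / (60 * Real.sqrt k) =
        (1 / 60 + 7 / 200 + 1 / 60) / Real.sqrt k := by
      field_simp
    rw [this]
    exact div_le_div_of_nonneg_right (by norm_num) hsk.le
  linarith

/-- `log(T + y) ≤ 4 + 4k` for `0 ≤ y ≤ 2`, `T ≥ 100`, `ℓ_T ≤ ck/2 + 1`, `c < 8`. [folklore] -/
theorem log_height_le' {T c y : ℝ} {k : ℕ} (hT : 100 ≤ T) (hℓ : ell T ≤ c * k / 2 + 1)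
    (hc8 : c < 8) (hy0 : 0 ≤ y) (hy2 : y ≤ 2) : Real.log (T + y) ≤ 4 + 4 * k := by
  have hT0 : 0 < T := by linarith
  have h0 : Real.log (T + y) ≤ Real.log (2 * T) := Real.log_le_log (by linarith) (by linarith)
  rw [Real.log_mul (by norm_num) hT0.ne'] at h0
  have h1 : Real.log T = ell T + Real.log (2 * Real.pi) := by
    rw [ell, Real.log_div hT0.ne' (by positivity)]; ring
  have h2 := Literature.Probability.LatticeModels.log_two_le_one
  have h3 := log_two_pi_bounds.2
  have hkk : (0 : ℝ) ≤ k := Nat.cast_nonneg k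
  have hck : c * k ≤ 8 * k := mul_le_mul_of_nonneg_right hc8.le hkk
  linarith

/-- The gain at a disc point: `e^{−(σ−1−δ')(ℓ/2−1)} ≤ 2e^{−(7a₀/4)k}` when `σ − 1 − δ' ≥ a₀`,
`7k/4 − 5 ≤ ℓ/2 − 1`, `0 ≤ a₀ ≤ 1/28`. [folklore] -/
theorem gain_exp_le' {a₀ σ δ' ℓ : ℝ} {k : ℕ} (ha₀ : 0 ≤ a₀) (ha₀1 : a₀ ≤ 1 / 28)
    (hℓ : 7 * (k : ℝ) / 4 - 5 ≤ ℓ / 2 - 1) (hℓ2 : 2 ≤ ℓ) (hσ : a₀ ≤ σ - (1 + δ')) :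
    Real.exp (-((σ - (1 + δ')) * (ℓ / 2 - 1))) ≤ 2 * Real.exp (-(7 * a₀ / 4 * k)) := by
  have hpos : 0 ≤ ℓ / 2 - 1 := by linarith
  have h1 : Real.exp (-((σ - (1 + δ')) * (ℓ / 2 - 1))) ≤ Real.exp (-(a₀ * (ℓ / 2 - 1))) := by
    apply Real.exp_le_exp.2
    have := mul_le_mul_of_nonneg_right hσ hpos
    linarith
  refine h1.trans ?_
  have h2 : Real.exp (-(a₀ * (ℓ / 2 - 1))) ≤ Real.exp (-(a₀ * (7 * (k : ℝ) / 4 - 5))) :=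
    Real.exp_le_exp.2 (by nlinarith)
  refine h2.trans ?_
  have h3 : -(a₀ * (7 * (k : ℝ) / 4 - 5)) = 5 * a₀ + -(7 * a₀ / 4 * k) := by ring
  rw [h3, Real.exp_add]
  apply mul_le_mul_of_nonneg_right _ (Real.exp_pos _).le
  have hx : |5 * a₀| ≤ 1 := by rw [abs_le]; constructor <;> nlinarith
  have := Real.abs_exp_sub_one_le hx
  have h4 := (abs_le.1 this).2
  have h5 : |5 * a₀| ≤ 1 / 2 := by rw [abs_le]; constructor <;> nlinarith
  linarith

/-- A product bound `672·L·e^{t}·g ≤ 672·(4+4k)·e^{14}·G`. [folklore] -/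
theorem triple_product_le' {L t g G : ℝ} {k : ℕ} (hL : L ≤ 4 + 4 * k) (ht : t ≤ 14)
    (hg0 : 0 ≤ g) (hg : g ≤ G) :
    672 * L * Real.exp t * g ≤ 672 * (4 + 4 * k) * Real.exp 14 * G := by
  have he : Real.exp t ≤ Real.exp 14 := Real.exp_le_exp.2 ht
  have h1 : 672 * L * Real.exp t ≤ 672 * (4 + 4 * k) * Real.exp 14 :=
    mul_le_mul (mul_le_mul_of_nonneg_left hL (by norm_num)) he (Real.exp_pos _).le (by positivity)
  exact mul_le_mul h1 hg hg0 (by positivity)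

/-- The near-zone flank bracket bound (flank constant `1 + 1/δ`). [folklore] -/
theorem near_flank_bracket_le {k : ℕ} {δ ψ₁ h L σ ℓ G : ℝ} (hδ : 0 < δ) (hψ₁0 : 0 ≤ ψ₁)
    (hψ₁1 : ψ₁ ≤ 1) (hh1 : h ≤ 3 / 5) (hL : L ≤ 4 + 4 * k)
    (hG : Real.exp (-((σ - (1 + δ)) * (ℓ / 2 - 1))) ≤ G) :
    Real.exp (12 * h + 6) * (1 + 1 / δ) * Real.exp (-(((k : ℝ) + 1) * (1 - Real.cos ψ₁))) +
        672 * L * Real.exp (2 * h + 1) * Real.exp (-((σ - (1 + δ)) * (ℓ / 2 - 1))) ≤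
      Real.exp 14 * (1 + 1 / δ) * Real.exp (-(ψ₁ ^ 2 / 4 * k)) +
        672 * (4 + 4 * k) * Real.exp 14 * G := by
  have hδinv : 0 ≤ 1 + 1 / δ := by have := one_div_pos.2 hδ; linarith
  have h1 : Real.exp (-(((k : ℝ) + 1) * (1 - Real.cos ψ₁))) ≤ Real.exp (-(ψ₁ ^ 2 / 4 * k)) := by
    apply Real.exp_le_exp.2
    have hc' := Literature.Analysis.InverseSpectral.sq_div_four_le_one_sub_cos
      (y := ψ₁) (abs_le.2 ⟨by linarith, hψ₁1⟩)
    have hk0' : (0 : ℝ) ≤ (k : ℝ) + 1 := by positivity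
    have h1 := mul_le_mul_of_nonneg_left hc' hk0'
    nlinarith [sq_nonneg ψ₁, h1]
  have h2 : Real.exp (12 * h + 6) * (1 + 1 / δ) * Real.exp (-(((k : ℝ) + 1) * (1 - Real.cos ψ₁))) ≤
      Real.exp 14 * (1 + 1 / δ) * Real.exp (-(ψ₁ ^ 2 / 4 * k)) :=
    mul_le_mul (mul_le_mul_of_nonneg_right (Real.exp_le_exp.2 (by linarith)) hδinv) h1
      (Real.exp_pos _).le (by positivity)
  have h3 := triple_product_le' (k := k) hL (by linarith : 2 * h + 1 ≤ 14) (Real.exp_pos _).le hG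
  linarith

/-- The near-zone bridge bracket bound. [folklore] -/
theorem near_bridge_bracket_le {k : ℕ} {δ h r d L σ ℓ G : ℝ} (hh1 : h ≤ 3 / 5) (hr : 0 < r)
    (hrinv : 1 / r ≤ 4) (hd1 : d ≤ 1) (hL0 : 0 ≤ L) (hL : L ≤ 4 + 4 * k)
    (hG : Real.exp (-((σ - (1 + δ)) * (ℓ / 2 - 1))) ≤ G) :
    d * (2 * (672 * L * Real.exp (2 * h + 11) * Real.exp (-((σ - (1 + δ)) * (ℓ / 2 - 1)))) / r) ≤
      2 * (672 * (4 + 4 * k) * Real.exp 14 * G) * 4 := by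
  have h3 := triple_product_le' (k := k) hL (by linarith : 2 * h + 11 ≤ 14) (Real.exp_pos _).le hG
  have hX0 : 0 ≤ 672 * L * Real.exp (2 * h + 11) * Real.exp (-((σ - (1 + δ)) * (ℓ / 2 - 1))) := by
    positivity
  have hq : 2 * (672 * L * Real.exp (2 * h + 11) * Real.exp (-((σ - (1 + δ)) * (ℓ / 2 - 1)))) / r ≤
      2 * (672 * (4 + 4 * k) * Real.exp 14 * G) * 4 := by
    rw [div_eq_mul_one_div]
    calc _ ≤ 2 * (672 * (4 + 4 * k) * Real.exp 14 * G) * (1 / r) :=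
          mul_le_mul_of_nonneg_right (by linarith) (by positivity)
      _ ≤ _ := mul_le_mul_of_nonneg_left hrinv (by linarith)
  have hq0 : 0 ≤ 2 * (672 * L * Real.exp (2 * h + 11) *
      Real.exp (-((σ - (1 + δ)) * (ℓ / 2 - 1)))) / r := by positivity
  calc _ ≤ 1 * (2 * (672 * L * Real.exp (2 * h + 11) *
        Real.exp (-((σ - (1 + δ)) * (ℓ / 2 - 1)))) / r) := mul_le_mul_of_nonneg_right hd1 hq0
    _ ≤ _ := by rw [one_mul]; exact hq

/-- **The near-zone junk is `≤ τ/√k`.** [folklore] -/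
theorem near_junk_le {k : ℕ} {δ ψ₁ a₀ τ F VB : ℝ} (hk : 1 ≤ (k : ℝ)) (hδ : 0 < δ) (hτ : 0 < τ)
    (hF : F ≤ Real.exp 14 * (1 + 1 / δ) * Real.exp (-(ψ₁ ^ 2 / 4 * k)) +
      672 * (4 + 4 * k) * Real.exp 14 * (2 * Real.exp (-(7 * a₀ / 4 * k))))
    (hVB : VB ≤ 2 * (672 * (4 + 4 * k) * Real.exp 14 * (2 * Real.exp (-(7 * a₀ / 4 * k)))) * 4)
    (hC : π * Real.exp 14 * (1 + 1 / δ) * (k : ℝ) ^ 2 * Real.exp (-(ψ₁ ^ 2 / 4 * k)) ≤ τ / 2)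
    (hD : 161280 * Real.exp 14 * (k : ℝ) ^ 2 * Real.exp (-(7 * a₀ / 4 * k)) ≤ τ / 2) :
    π * F + VB ≤ τ / Real.sqrt k := by
  have hk0 : (0 : ℝ) < k := by linarith
  have hsk : 0 < Real.sqrt k := Real.sqrt_pos.2 hk0
  have hsq : Real.sqrt k * Real.sqrt k = k := Real.mul_self_sqrt hk0.le
  have hsk1 : 1 ≤ Real.sqrt k := by
    rw [show (1 : ℝ) = Real.sqrt 1 by simp]; exact Real.sqrt_le_sqrt hk
  have hs_le : Real.sqrt k ≤ k := by nlinarith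
  have hpi : π < 3.1416 := Real.pi_lt_d4
  have hpi0 : 0 < π := Real.pi_pos
  set e1 : ℝ := Real.exp (-(ψ₁ ^ 2 / 4 * k)) with he1
  set e2 : ℝ := Real.exp (-(7 * a₀ / 4 * k)) with he2
  set E : ℝ := Real.exp 14 with hE
  have he1p : 0 < e1 := Real.exp_pos _
  have he2p : 0 < e2 := Real.exp_pos _
  have hEp : 0 < E := Real.exp_pos _
  have hδinv : 0 < 1 + 1 / δ := by have := one_div_pos.2 hδ; linarith
  have hT1 : π * E * (1 + 1 / δ) * e1 ≤ τ / 2 / Real.sqrt k := by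
    rw [le_div_iff₀ hsk]
    have : π * E * (1 + 1 / δ) * e1 * Real.sqrt k ≤ π * E * (1 + 1 / δ) * (k : ℝ) ^ 2 * e1 := by
      have hkk : Real.sqrt k ≤ (k : ℝ) ^ 2 := by nlinarith
      have hpos : 0 ≤ π * E * (1 + 1 / δ) * e1 := by positivity
      nlinarith
    linarith
  have hT2 : 161280 * E * (k : ℝ) * e2 ≤ τ / 2 / Real.sqrt k := by
    rw [le_div_iff₀ hsk]
    have : 161280 * E * (k : ℝ) * e2 * Real.sqrt k ≤ 161280 * E * (k : ℝ) ^ 2 * e2 := by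
      have hpos : 0 ≤ 161280 * E * (k : ℝ) * e2 := by positivity
      nlinarith
    linarith
  have hcollect : π * F + VB ≤ π * E * (1 + 1 / δ) * e1 + 672 * (4 + 4 * k) * E * (2 * e2) * (π + 8) := by
    have hpos : 0 ≤ 672 * (4 + 4 * (k : ℝ)) * E * (2 * e2) := by positivity
    nlinarith
  have hsecond : 672 * (4 + 4 * (k : ℝ)) * E * (2 * e2) * (π + 8) ≤ 161280 * E * k * e2 := by
    have : 672 * (4 + 4 * (k : ℝ)) * E * (2 * e2) * (π + 8) ≤ 672 * (8 * k) * E * (2 * e2) * 15 := by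
      have h15 : π + 8 ≤ 15 := by linarith
      have h8 : 4 + 4 * (k : ℝ) ≤ 8 * k := by linarith
      have hpos1 : 0 ≤ 672 * (4 + 4 * (k : ℝ)) * E * (2 * e2) := by positivity
      have hpos2 : 0 ≤ E * (2 * e2) * 15 := by positivity
      nlinarith
    linarith
  have hfin : τ / 2 / Real.sqrt k + τ / 2 / Real.sqrt k = τ / Real.sqrt k := by
    field_simp; ring
  linarith

/-- **The disc bound, abstractly.** From the window lemma `‖U − Mn‖ ≤ N·I·(Z·W + J)`, the size
`‖Mn‖ = N·I·Z·s`, `s ≥ 2/q`, `Z ≥ z₀ > 0`, `W ≤ (1/10)/q`, `J ≤ (z₀/100)/q`, and the model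
comparison `‖Mn − M‖ ≤ ‖M‖/100`: `‖U − M‖ ≤ ‖M‖/3`. [folklore] -/
theorem disc_bound_core {U Mn M : ℂ} {N I Z s W J z₀ q : ℝ} (hN : 0 < N) (hI : 0 < I)
    (hq : 0 < q) (hz₀ : 0 < z₀) (hS5 : ‖U - Mn‖ ≤ N * (I * (Z * W + J)))
    (hMn : ‖Mn‖ = N * (I * Z * s)) (hs : 2 / q ≤ s) (hZ : z₀ ≤ Z)
    (hW : W ≤ 1 / 10 / q) (hJ : J ≤ z₀ / 100 / q)
    (hcmp : ‖Mn - M‖ ≤ 1 / 100 * ‖M‖) : ‖U - M‖ ≤ 1 / 3 * ‖M‖ := by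
  have hZ0 : 0 < Z := lt_of_lt_of_le hz₀ hZ
  have hs0 : 0 < s := lt_of_lt_of_le (by positivity) hs
  -- `Z W + J ≤ (Z s)·(1/20 + 1/200)`
  have hW' : Z * W ≤ Z * s * (1 / 20) := by
    have : W ≤ s * (1 / 20) := by
      calc W ≤ 1 / 10 / q := hW
        _ = (2 / q) * (1 / 20) := by ring
        _ ≤ s * (1 / 20) := mul_le_mul_of_nonneg_right hs (by norm_num)
    nlinarith
  have hJ' : J ≤ Z * s * (1 / 200) := by
    calc J ≤ z₀ / 100 / q := hJ
      _ = z₀ * (2 / q) * (1 / 200) := by ring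
      _ ≤ Z * s * (1 / 200) := by
          apply mul_le_mul_of_nonneg_right _ (by norm_num)
          exact mul_le_mul hZ hs (by positivity) hZ0.le
  have h1 : ‖U - Mn‖ ≤ 11 / 200 * ‖Mn‖ := by
    rw [hMn]
    have : N * (I * (Z * W + J)) ≤ N * (I * (Z * s * (1 / 20) + Z * s * (1 / 200))) := by
      apply mul_le_mul_of_nonneg_left _ hN.le
      exact mul_le_mul_of_nonneg_left (add_le_add hW' hJ') hI.le
    linarith
  have h2 : ‖Mn‖ ≤ ‖M‖ + 1 / 100 * ‖M‖ := by
    have := norm_sub_norm_le Mn M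
    linarith
  calc ‖U - M‖ = ‖(U - Mn) + (Mn - M)‖ := by ring_nf
    _ ≤ ‖U - Mn‖ + ‖Mn - M‖ := norm_add_le _ _
    _ ≤ 11 / 200 * (‖M‖ + 1 / 100 * ‖M‖) + 1 / 100 * ‖M‖ := by
        have := mul_le_mul_of_nonneg_left h2 (by norm_num : (0 : ℝ) ≤ 11 / 200)
        linarith
    _ ≤ 1 / 3 * ‖M‖ := by nlinarith [norm_nonneg M]

end Summit.RiemannHypothesis.RiemannHypothesis.Theorems.JensenPolynomials.LogBandArc

end
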